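import Summits.HubbardSuperconductivity.HubbardLadder.R3R4SumRule
import Literature.MathematicalPhysics.QuantumLattice.LocalPairOn
import Literature.Probability.LatticeModels.TorusBipartite
import Summits.HubbardSuperconductivity.HubbardSuperconductivity.Theorems.EnslavedA1gTorusNormalForms
import HarnessLib

/-!
# Rung R3 tooling — the STAGGERED (`q = (π,π)`) SUM RULE of the `d`-wave pair correlator:
# `Σ_{r ∈ Λ_L} (−1)^{r₁+r₂} P̄_d(L, r; ψ) = 0` for EVERY state `ψ` on EVERY torus of even side `L`

HONEST FRAMING (page 1): ladder R1–R4 with certified numbers; no claim on H/H₀.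

HONEST LABEL: an EXACT OPERATOR IDENTITY and its consequences for the R3 observable `avgPairCorr` — PROVED,
no certificate, no number, nothing run (2026-08-21). It is the kernel form of the pre-flight bug check P60 (g)(i)
booked for the cell's first finite-torus pair-row instance `pairrows1` (LEAD LINE (KK) 2026-08-21T07:46:34Z, after
`pub-hubbard-pseudo` §13 P60 (g)): "`Δ_d(q = (π,π)) ≡ 0` for the four-bond singlet `d`-wave field, hence at ANY state
`V00 − 4·V10 + 4·V11 + 2·V20 − 4·V21 + V22 = 0`". Result line (iii) of record is unchanged: no R3 instance has been
run; no dichotomy is certified at any size; there are no brackets to overlap.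

MATHEMATICS. Let `L` be even, `ε(x) = (−1)^{x₁+x₂}` the sublattice sign of the torus `(ℤ/Lℤ)²` (well defined
because `L` is even; `Literature.Probability.LatticeModels.torusSiteParity`), and
`P_x = Σ_{e ∈ {0,±e₁,±e₂}} (g(e)/√2)·B_x(e)`, `B_x(e) = c_{x↑}c_{x+e,↓} − c_{x↓}c_{x+e,↑}` the local singlet pair with
form factor `g` (`localPair g L x`). If `g(0) = 0` and `g(−eᵢ) = g(eᵢ)` (the `d_{x²−y²}` factor `dWaveFormFactor`, and
the extended-`s` factor), then the STAGGERED PAIR FIELD VANISHES IDENTICALLY: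
`A_ε := Σ_x ε(x) P_x = 0` (§2, `sum_stagger_smul_localPair_eq_zero`). Proof: the singlet bond is symmetric in its
two ends, `B_x(−e) = B_{x−e}(e)` (CAR; `singletBond_neg`, in tree), and `ε(x + eᵢ) = −ε(x)`; so
`Σ_x ε(x) B_x(−eᵢ) = Σ_y ε(y + eᵢ) B_y(eᵢ) = −Σ_y ε(y) B_y(eᵢ)` and the `±eᵢ` terms cancel pairwise. (For the ON-SITE
`s`-wave factor the staggered field is Yang's `η` operator and does NOT vanish — the hypothesis `g(0) = 0` is used.)
Consequences (§3–§4), for every state `ψ` (no symmetry, no ground-state property, any particle number):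
`Σ_{x,y} ε(x)ε(y) ⟨ψ, P_x† P_y ψ⟩ = ⟨ψ, A_ε† A_ε ψ⟩ = 0`; with `ε(x)ε(y) = ε(y − x)`,
`Σ_s ε(s) Σ_x ⟨ψ, P_x† P_{x+s} ψ⟩ = 0`; in the R3 vocabulary (`avgPairCorr`, R3R4Props; fundamental domain
`halfOpenBox 2 L` reindexed by the torus, `sum_halfOpenBox_torusProj`):
`Σ_{r ∈ [0,L)²} ε(r) · P̄_d(L, r; ψ) = 0` (`sum_stagger_mul_avgPairCorr_eq_zero`, side written `L + 1` with
`2 ∣ L + 1` to match `avgPairCorr_succ`). Equivalently: the pair structure factor of the `d`-wave field at the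
antiferromagnetic wavevector is identically zero, so `P̄_d` carries exactly as much weight on the odd sublattice of
displacements as on the even one. At `L = 4` the 16 displacements group under the inversion `r ↦ −r` (which fixes
`P̄_d` for every `ψ`) and, for a `D₄`-invariant functional (e.g. a symmetry-reduced SDP pseudo-state or a
sector-averaged ground-state functional), under the full point group into the classes
`(0,0)×1, (1,0)×4, (1,1)×4, (2,0)×2, (2,1)×4, (2,2)×1` with signs `+ − + + − +`: the printed form
`V00 − 4·V10 + 4·V11 + 2·V20 − 4·V21 + V22 = 0` of P60 (g)(i). The per-state 16-term identity proved here is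
the stronger statement (no point-group hypothesis).

USE. (a) Bug check of record for any `pair_dd` producer profile `ω(V_r)/16`, `r ∈ [0,4)²` (a violation beyond solver
tolerance is a kernel/multiplicity/reduction BUG SIGNAL, LEAD LINE (KK)); (b) an exact linear row among the
`P̄_d(L, ·)` rows of every future pair-row instance, at every even `L`, free of charge; (c) at `L = 4` it ties the one
"clean" displacement `(2,2)` to the contact-contaminated ones exactly.

Contents: §1 `stagger` (the sign `ε` as a complex unit) and its algebra on the even torus (`stagger_add`,
`stagger_add_single`, `stagger_neg`, `stagger_sub`, `star_stagger`, `stagger_im`); §2 `sum_stagger_smul_singletBond_neg_single`,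
`sum_stagger_smul_localPair_eq_zero`; §3 `sum_sum_stagger_mul_expect_localPair_eq_zero`,
`sum_stagger_mul_pairCorrSum_eq_zero`, `sum_stagger_re_mul_pairCorrSum_re_eq_zero`; §4
`sum_stagger_mul_avgPairCorr_eq_zero` (the R3 row form, `g = dWaveFormFactor`). §5 — the explicit sixteen-term
identity `avgPairCorr_four_staggered_sum_eq_zero` on the `4 × 4` torus (`sum_univ_torusSite_four`, `avgPairCorr_four`) —
lives in the companion file `PairCorrStaggeredSumRuleFour.lean` (same request; split only for the 400-line file-size lint).

References: Scalapino, Phys. Rep. 250 (1995) 329, §2 eqs. (2.2)–(2.4) (pair field, form factors, `P_d(r)`);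
Yang, Rev. Mod. Phys. 34 (1962) 694, §4 and Yang, PRL 63 (1989) 2144 (the `η` operator — the on-site contrast);
Qin et al., PRX 10 (2020) 031016, §II eqs. (2)–(4) (`P̄_d`); Dyson–Lieb–Simon, J. Stat. Phys. 18 (1978) 335, §2
(bipartite even torus). The identity itself is folklore (momentum conservation of the bond-singlet field on a
bipartite lattice); no published statement of the 16-term form was found (queries recorded in the cell notes).
-/

noncomputable section

namespace Summit.HubbardSuperconductivity.HubbardLadder

open Matrix Literature.MathematicalPhysics.QuantumLattice Literature.Probability.LatticeModels
open Finset hiding expect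
open scoped ComplexOrder

/-! ## §1 The sublattice sign `ε(x) = (−1)^{x₁+x₂}` on the torus of even side -/

section Stagger

variable {L : ℕ}

/-- The sublattice (staggering) sign of a site of the torus of even side, as a complex unit:
`ε(x) = +1` on the even sublattice `Σᵢ xᵢ ≡ 0 (mod 2)`, `−1` on the odd one.
[cite: DysonLiebSimon1978, §2] [folklore] -/
def stagger (hL : 2 ∣ L) (x : TorusSite 2 L) : ℂ :=
  if torusSiteParity hL x = 0 then 1 else -1

/-- The parity map is additive. [cite: DysonLiebSimon1978, §2] [folklore] -/
theorem torusSiteParity_add (hL : 2 ∣ L) (x y : TorusSite 2 L) :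
    torusSiteParity hL (x + y) = torusSiteParity hL x + torusSiteParity hL y := by
  unfold torusSiteParity
  simp only [Pi.add_apply, map_add, Finset.sum_add_distrib]

/-- The parity map is odd (hence even: `−t = t` in `ℤ/2ℤ`). [cite: DysonLiebSimon1978, §2] [folklore] -/
theorem torusSiteParity_neg (hL : 2 ∣ L) (x : TorusSite 2 L) :
    torusSiteParity hL (-x) = torusSiteParity hL x := by
  have hneg : ∀ t : ZMod 2, -t = t := by decide
  unfold torusSiteParity
  simp only [Pi.neg_apply, map_neg, hneg]

/-- `ε(x + y) = ε(x) ε(y)`. [folklore] -/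
theorem stagger_add (hL : 2 ∣ L) (x y : TorusSite 2 L) :
    stagger hL (x + y) = stagger hL x * stagger hL y := by
  have h01 : ∀ t : ZMod 2, t = 0 ∨ t = 1 := by decide
  have h10 : (1 : ZMod 2) ≠ 0 := by decide
  have h11 : (1 : ZMod 2) + 1 = 0 := by decide
  unfold stagger
  rw [torusSiteParity_add]
  rcases h01 (torusSiteParity hL x) with hx | hx <;> rcases h01 (torusSiteParity hL y) with hy | hy
  · rw [hx, hy, add_zero, if_pos rfl, one_mul]
  · rw [hx, hy, zero_add, if_neg h10, if_pos rfl, one_mul]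
  · rw [hx, hy, add_zero, if_neg h10, if_pos rfl, mul_one]
  · rw [hx, hy, h11, if_pos rfl, if_neg h10]; norm_num

/-- `ε(−x) = ε(x)`. [folklore] -/
theorem stagger_neg (hL : 2 ∣ L) (x : TorusSite 2 L) : stagger hL (-x) = stagger hL x := by
  unfold stagger
  rw [torusSiteParity_neg]

/-- `ε(y − x) = ε(y) ε(x)`. [folklore] -/
theorem stagger_sub (hL : 2 ∣ L) (y x : TorusSite 2 L) :
    stagger hL (y - x) = stagger hL y * stagger hL x := by
  rw [sub_eq_add_neg, stagger_add, stagger_neg]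

/-- `ε(x)² = 1`. [folklore] -/
theorem stagger_mul_self (hL : 2 ∣ L) (x : TorusSite 2 L) : stagger hL x * stagger hL x = 1 := by
  unfold stagger
  split_ifs <;> norm_num

/-- `ε` is real: `conj ε(x) = ε(x)`. [folklore] -/
theorem star_stagger (hL : 2 ∣ L) (x : TorusSite 2 L) : star (stagger hL x) = stagger hL x := by
  unfold stagger
  split_ifs <;> simp

/-- `ε` is real: `Im ε(x) = 0`. [folklore] -/
theorem stagger_im (hL : 2 ∣ L) (x : TorusSite 2 L) : (stagger hL x).im = 0 := by
  unfold stagger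
  split_ifs <;> simp

/-- `Re ε(x) = ±1` according to the sublattice. [folklore] -/
theorem stagger_re (hL : 2 ∣ L) (x : TorusSite 2 L) :
    (stagger hL x).re = if torusSiteParity hL x = 0 then 1 else -1 := by
  unfold stagger
  split_ifs <;> simp

/-- The sign flips along every lattice direction of the even torus: `ε(x + eᵢ) = −ε(x)`.
[cite: DysonLiebSimon1978, §2] [folklore] -/
theorem stagger_add_single (hL : 2 ∣ L) (x : TorusSite 2 L) (i : Fin 2) :
    stagger hL (x + Pi.single i 1) = -stagger hL x := by
  have h01 : ∀ t : ZMod 2, t = 0 ∨ t = 1 := by decide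
  have h10 : (1 : ZMod 2) ≠ 0 := by decide
  have h11 : (1 : ZMod 2) + 1 = 0 := by decide
  unfold stagger
  rw [torusSiteParity_add_single]
  rcases h01 (torusSiteParity hL x) with hx | hx
  · rw [hx, zero_add, if_neg h10, if_pos rfl]
  · rw [hx, h11, if_pos rfl, if_neg h10, neg_neg]

-- `Torus.proj` of a unit step: the landed `Summit.HubbardSuperconductivity.EnslavedA1g.torusProj_single`
-- (EnslavedA1gTorusNormalForms.lean) is reused by import (filer's `dedup.landed` edit of LEAN FILING REQUEST #193 (A)).

end Stagger

/-! ## §2 The staggered pair field with an even, origin-free form factor vanishes identically -/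

section StaggeredField

variable {L : ℕ} [NeZero L]

/-- Bond reversal under the staggered sum: `Σ_x ε(x) B_x(−eᵢ) = −Σ_x ε(x) B_x(eᵢ)`
(`B_x(−e) = B_{x−e}(e)`, reindex `x = y + e`, `ε(y + eᵢ) = −ε(y)`).
[cite: Scalapino1995, §2 eq. (2.2)–(2.3)] [folklore] -/
theorem sum_stagger_smul_singletBond_neg_single (hL : 2 ∣ L) (i : Fin 2) :
    ∑ x : TorusSite 2 L, stagger hL x • singletBond L x (-Pi.single i 1) =
      -∑ x : TorusSite 2 L, stagger hL x • singletBond L x (Pi.single i 1) := by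
  calc ∑ x : TorusSite 2 L, stagger hL x • singletBond L x (-Pi.single i 1)
      = ∑ x : TorusSite 2 L, stagger hL x •
          singletBond L (x - Torus.proj L (Pi.single i 1)) (Pi.single i 1) := by
        simp_rw [singletBond_neg]
    _ = ∑ y : TorusSite 2 L, stagger hL (y + Torus.proj L (Pi.single i 1)) •
          singletBond L y (Pi.single i 1) :=
        Fintype.sum_equiv (Equiv.subRight (Torus.proj L (Pi.single i 1))) _ _ fun x => by
          simp only [Equiv.subRight_apply, sub_add_cancel]
    _ = -∑ y : TorusSite 2 L, stagger hL y • singletBond L y (Pi.single i 1) := by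
        rw [← Finset.sum_neg_distrib]
        refine Finset.sum_congr rfl fun y _ => ?_
        rw [Summit.HubbardSuperconductivity.EnslavedA1g.torusProj_single, stagger_add_single, neg_smul]

/-- `0` is not one of the four unit steps of `ℤ²` (local copy). [folklore] -/
private theorem zero_not_mem_unitSteps' : (0 : Site 2) ∉ unitSteps := by
  simp only [unitSteps, Finset.mem_insert, Finset.mem_singleton]
  decide

/-- A sum over the four unit steps `{e₁, −e₁, e₂, −e₂}` of `ℤ²`, expanded (local copy). [folklore] -/
private theorem sum_unitSteps' {M : Type*} [AddCommMonoid M] (f : Site 2 → M) :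
    ∑ e ∈ unitSteps, f e =
      f (Pi.single 0 1) + (f (-Pi.single 0 1) + (f (Pi.single 1 1) + f (-Pi.single 1 1))) := by
  have h1 : (Pi.single 0 1 : Site 2) ∉
      ({-Pi.single 0 1, Pi.single 1 1, -Pi.single 1 1} : Finset (Site 2)) := by
    simp only [Finset.mem_insert, Finset.mem_singleton]; decide
  have h2 : (-Pi.single 0 1 : Site 2) ∉ ({Pi.single 1 1, -Pi.single 1 1} : Finset (Site 2)) := by
    simp only [Finset.mem_insert, Finset.mem_singleton]; decide
  have h3 : (Pi.single 1 1 : Site 2) ∉ ({-Pi.single 1 1} : Finset (Site 2)) := by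
    simp only [Finset.mem_singleton]; decide
  rw [unitSteps, Finset.sum_insert h1, Finset.sum_insert h2, Finset.sum_insert h3,
    Finset.sum_singleton]

/-- **The staggered pair field vanishes.** For a form factor with `g(0) = 0` and `g(−eᵢ) = g(eᵢ)`
(`d_{x²−y²}`, extended `s`), `A_ε = Σ_x ε(x) P_x = 0` on every torus of even side: the pair field built from
symmetric nearest-neighbour singlet bonds carries no weight at the antiferromagnetic wavevector `(π,π)`.
(Contrast: for the on-site factor `A_ε` is Yang's `η` operator, which is not zero.)
[cite: Scalapino1995, §2 eq. (2.2)–(2.3)] [cite: Yang1989, eq. (3)] [folklore] -/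
theorem sum_stagger_smul_localPair_eq_zero (hL : 2 ∣ L) (g : Site 2 → ℝ) (hg0 : g 0 = 0)
    (hg : ∀ i : Fin 2, g (-Pi.single i 1) = g (Pi.single i 1)) :
    ∑ x : TorusSite 2 L, stagger hL x • localPair g L x = 0 := by
  calc ∑ x : TorusSite 2 L, stagger hL x • localPair g L x
      = ∑ x : TorusSite 2 L, ∑ e ∈ insert (0 : Site 2) unitSteps,
          stagger hL x • (((g e / Real.sqrt 2 : ℝ) : ℂ) • singletBond L x e) := by
        refine Finset.sum_congr rfl fun x _ => ?_
        rw [← localPairOn_insert_zero_unitSteps, localPairOn_eq_sum_singletBond, Finset.smul_sum]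
    _ = ∑ e ∈ insert (0 : Site 2) unitSteps, ((g e / Real.sqrt 2 : ℝ) : ℂ) •
          ∑ x : TorusSite 2 L, stagger hL x • singletBond L x e := by
        rw [Finset.sum_comm]
        refine Finset.sum_congr rfl fun e _ => ?_
        rw [Finset.smul_sum]
        refine Finset.sum_congr rfl fun x _ => ?_
        rw [smul_comm]
    _ = 0 := by
        rw [Finset.sum_insert zero_not_mem_unitSteps', hg0, zero_div, Complex.ofReal_zero, zero_smul,
          zero_add, sum_unitSteps', sum_stagger_smul_singletBond_neg_single hL 0,
          sum_stagger_smul_singletBond_neg_single hL 1, hg 0, hg 1, smul_neg, smul_neg]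
        abel

/-- The `d_{x²−y²}` case: `Σ_x ε(x) Δ_x = 0`. [cite: Scalapino1995, §2 eq. (2.3)] [folklore] -/
theorem sum_stagger_smul_localPair_dWave_eq_zero (hL : 2 ∣ L) :
    ∑ x : TorusSite 2 L, stagger hL x • localPair dWaveFormFactor L x = 0 :=
  sum_stagger_smul_localPair_eq_zero hL dWaveFormFactor dWaveFormFactor_zero
    fun _ => dWaveFormFactor_neg _

end StaggeredField

/-! ## §3 Consequences for pair–pair correlations of an arbitrary state -/

section Correlations

variable {L : ℕ} [NeZero L]

/-- `Σ_{x,y} ε(x) ε(y) ⟨ψ, P_x† P_y ψ⟩ = ⟨ψ, A_ε† A_ε ψ⟩ = 0` for every state `ψ`.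
[cite: Scalapino1995, §2 eq. (2.4)] [folklore] -/
theorem sum_sum_stagger_mul_expect_localPair_eq_zero (hL : 2 ∣ L) (g : Site 2 → ℝ) (hg0 : g 0 = 0)
    (hg : ∀ i : Fin 2, g (-Pi.single i 1) = g (Pi.single i 1)) (ψ : Fock (Orb (FermionTorus 2 L))) :
    ∑ x : TorusSite 2 L, ∑ y : TorusSite 2 L,
      stagger hL x * stagger hL y * expect ((localPair g L x)ᴴ * localPair g L y) ψ = 0 := by
  have hA := sum_stagger_smul_localPair_eq_zero hL g hg0 hg
  have hAH : (∑ x : TorusSite 2 L, stagger hL x • localPair g L x)ᴴ =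
      ∑ x : TorusSite 2 L, stagger hL x • (localPair g L x)ᴴ := by
    rw [conjTranspose_sum]
    refine Finset.sum_congr rfl fun x _ => ?_
    rw [conjTranspose_smul, star_stagger]
  calc ∑ x : TorusSite 2 L, ∑ y : TorusSite 2 L,
        stagger hL x * stagger hL y * expect ((localPair g L x)ᴴ * localPair g L y) ψ
      = expect ((∑ x : TorusSite 2 L, stagger hL x • localPair g L x)ᴴ *
          ∑ y : TorusSite 2 L, stagger hL y • localPair g L y) ψ := by
        rw [hAH, Finset.sum_mul, expect_sum]
        refine Finset.sum_congr rfl fun x _ => ?_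
        rw [Finset.mul_sum, expect_sum]
        refine Finset.sum_congr rfl fun y _ => ?_
        rw [Matrix.smul_mul, Matrix.mul_smul, smul_smul, expect_smul]
    _ = 0 := by
        rw [hA, conjTranspose_zero, Matrix.zero_mul]
        simp [Literature.MathematicalPhysics.QuantumLattice.expect]

/-- Displacement form: `Σ_s ε(s) Σ_x ⟨ψ, P_x† P_{x+s} ψ⟩ = 0` (`ε(x) ε(x+s) = ε(s)`).
[cite: Scalapino1995, §2 eq. (2.4)] [folklore] -/
theorem sum_stagger_mul_pairCorrSum_eq_zero (hL : 2 ∣ L) (g : Site 2 → ℝ) (hg0 : g 0 = 0)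
    (hg : ∀ i : Fin 2, g (-Pi.single i 1) = g (Pi.single i 1)) (ψ : Fock (Orb (FermionTorus 2 L))) :
    ∑ s : TorusSite 2 L, stagger hL s *
      ∑ x : TorusSite 2 L, expect ((localPair g L x)ᴴ * localPair g L (x + s)) ψ = 0 := by
  calc ∑ s : TorusSite 2 L, stagger hL s *
        ∑ x : TorusSite 2 L, expect ((localPair g L x)ᴴ * localPair g L (x + s)) ψ
      = ∑ x : TorusSite 2 L, ∑ s : TorusSite 2 L,
          stagger hL s * expect ((localPair g L x)ᴴ * localPair g L (x + s)) ψ := by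
        simp only [Finset.mul_sum]
        exact Finset.sum_comm
    _ = ∑ x : TorusSite 2 L, ∑ y : TorusSite 2 L,
          stagger hL x * stagger hL y * expect ((localPair g L x)ᴴ * localPair g L y) ψ := by
        refine Finset.sum_congr rfl fun x _ => ?_
        refine (Fintype.sum_equiv (Equiv.subRight x) _ _ fun y => ?_).symm
        rw [Equiv.subRight_apply, show x + (y - x) = y by abel, stagger_sub hL y x,
          mul_comm (stagger hL y) (stagger hL x)]
    _ = 0 := sum_sum_stagger_mul_expect_localPair_eq_zero hL g hg0 hg ψ

/-- Real form: `Σ_s ε(s) · Σ_x Re⟨ψ, P_x† P_{x+s} ψ⟩ = 0` (`ε` is real).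
[cite: Scalapino1995, §2 eq. (2.4)] [folklore] -/
theorem sum_stagger_re_mul_pairCorrSum_re_eq_zero (hL : 2 ∣ L) (g : Site 2 → ℝ) (hg0 : g 0 = 0)
    (hg : ∀ i : Fin 2, g (-Pi.single i 1) = g (Pi.single i 1)) (ψ : Fock (Orb (FermionTorus 2 L))) :
    ∑ s : TorusSite 2 L, (stagger hL s).re *
      ∑ x : TorusSite 2 L, (expect ((localPair g L x)ᴴ * localPair g L (x + s)) ψ).re = 0 := by
  have h := congrArg Complex.re (sum_stagger_mul_pairCorrSum_eq_zero hL g hg0 hg ψ)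
  rw [Complex.zero_re, Complex.re_sum] at h
  rw [← h]
  refine Finset.sum_congr rfl fun s _ => ?_
  rw [Complex.mul_re, stagger_im, zero_mul, sub_zero, Complex.re_sum]

end Correlations

/-! ## §4 The R3 row form: `Σ_{r ∈ [0,L)²} ε(r) P̄_d(L, r; ψ) = 0` -/

section Rows

/-- **Staggered sum rule for the translation-averaged `d`-wave pair correlator** (R3 observable
`avgPairCorr`, R3R4Props): on the torus of EVEN side `L + 1` (hypothesis `2 ∣ L + 1`), for EVERY state `ψ`,
`Σ_{r ∈ [0, L+1)²} ε(r) · P̄_d(L+1, r; ψ) = 0`, `ε(r) = (−1)^{r₁+r₂}` (read through `Torus.proj`). At `L + 1 = 4`: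
the signed sum of the 16 rows `P̄_d(4, (a,b); ψ)`, sign `(−1)^{a+b}`, vanishes; for a `D₄`-invariant functional this
is `V00 − 4·V10 + 4·V11 + 2·V20 − 4·V21 + V22 = 0` (P60 (g)(i)).
[cite: Scalapino1995, §2 eq. (2.4)] [cite: QinEtAl2020, §II eq. (2)–(4)] [folklore] -/
theorem sum_stagger_mul_avgPairCorr_eq_zero (L : ℕ) (hL : 2 ∣ L + 1)
    (ψ : Fock (Orb (FermionTorus 2 (L + 1)))) :
    ∑ r ∈ halfOpenBox 2 (L + 1),
      (stagger hL (Torus.proj (L + 1) r)).re * avgPairCorr (L + 1) r ψ = 0 := by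
  have hL0 : ((L + 1 : ℕ) : ℝ) ≠ 0 := by positivity
  calc ∑ r ∈ halfOpenBox 2 (L + 1), (stagger hL (Torus.proj (L + 1) r)).re * avgPairCorr (L + 1) r ψ
      = (∑ r ∈ halfOpenBox 2 (L + 1), (stagger hL (Torus.proj (L + 1) r)).re *
          ∑ x : TorusSite 2 (L + 1),
            (expect ((localPair dWaveFormFactor (L + 1) x)ᴴ *
              localPair dWaveFormFactor (L + 1) (x + Torus.proj (L + 1) r)) ψ).re) /
          ((L + 1 : ℕ) : ℝ) ^ 2 := by
        rw [Finset.sum_div]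
        refine Finset.sum_congr rfl fun r _ => ?_
        rw [avgPairCorr_succ, mul_div_assoc]
    _ = (∑ s : TorusSite 2 (L + 1), (stagger hL s).re *
          ∑ x : TorusSite 2 (L + 1),
            (expect ((localPair dWaveFormFactor (L + 1) x)ᴴ *
              localPair dWaveFormFactor (L + 1) (x + s)) ψ).re) / ((L + 1 : ℕ) : ℝ) ^ 2 := by
        rw [sum_halfOpenBox_torusProj (L + 1) (fun s => (stagger hL s).re *
          ∑ x : TorusSite 2 (L + 1),
            (expect ((localPair dWaveFormFactor (L + 1) x)ᴴ *
              localPair dWaveFormFactor (L + 1) (x + s)) ψ).re)]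
    _ = 0 := by
        rw [sum_stagger_re_mul_pairCorrSum_re_eq_zero hL dWaveFormFactor dWaveFormFactor_zero
          (fun _ => dWaveFormFactor_neg _) ψ, zero_div]

end Rows

end Summit.HubbardSuperconductivity.HubbardLadder

end
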